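import Summits.AtomisticToContinuum.BoseEinsteinCondensation.Theorems.StaticResponseBound.Negative.CellToolkit
import Summits.AtomisticToContinuum.BoseEinsteinCondensation.Theorems.StaticResponseBound.Negative.Basic

/-!
# Negative lemmas for crux `InfraredMinimumUncertainty` (stmt-AtomisticToContinuum-11784) — I:
# trigonometric / Fubini / Jensen toolkit on the cell

Supports (does not close) stmt-AtomisticToContinuum-11784 (route `BECConjugateDomination`).
Importable form of §T of the cdisprove seat's standing file
`Cruxes/InfraredMinimumUncertainty/Disproof.lean` (generation 1), on top of the sibling toolkit
`Theorems/StaticResponseBound/Negative/CellToolkit.lean` (`arg = θ_k`, `phiMode = 1 + 2ε cos θ_k`):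

* `arg_add`, `im_cellWave`, `integral_cell_sin_arg` (`∫_cell sin θ_k = 0`),
  `integral_cell_cos_arg_add` (`∫_cell cos(θ_k + α) = 0`, `k ≠ 0`);
* `phiMode_shift_mul`, `integral_cell_phiMode_shift_mul`:
  `∫_cell φ_ε(x + r) φ_ε(x) dx = (1 + 2ε² cos θ_k(r)) L³` — the shifted overlap that gives the
  coherence `g` of a product state in closed form;
* `mul_log_one_add_mul_ge`: `t(1 − t) w² ≤ w · log(1 + t w)` (`0 ≤ t ≤ 1/2`, `|w| ≤ 1`) — the
  elementary bound behind the positivity of the Lévy weight of a density wave;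
* `integral_cellN_prod_real` (real Fubini on `cell^N`) and `sq_integral_le_integral_sq`
  (weighted Jensen `(∫ f|Ψ|²)² ≤ ∫ f²|Ψ|²` for an admissible `Ψ`).
-/

noncomputable section

open MeasureTheory Filter Set
open scoped ENNReal NNReal Topology ComplexConjugate BigOperators

namespace Summit.AtomisticToContinuum.BoseEinsteinCondensation.Theorems.InfraredMinimumUncertainty.Negative

open Literature.MathematicalPhysics.QuantumManyBody.BoseGas
open Summit.AtomisticToContinuum.BoseEinsteinCondensation.Theorems.StaticResponseBound.Negative
  (arg arg_intSMul re_cellWave integral_cell_cos_arg integral_cell_const phiMode continuous_arg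
    contDiff_arg continuous_phiMode contDiff_phiMode arg_add_single phiMode_periodic phiMode_pos
    integral_cell_trig_combo integral_cell_phiMode_sq integral_cell_cos_mul_phiMode_sq
    isFiniteMeasure_restrict_cell argCLM argCLM_apply argCLM_single hasFDerivAt_phiMode
    isRepulsiveFiniteRange_zero integral_norm_sq_eq_one)

/-! ## §T  Toolkit: phases, shifted products, an elementary log bound, Fubini and Jensen -/

section Toolkit

variable {L : ℝ}

/-- `θ_k` is additive: `θ_k(x + y) = θ_k(x) + θ_k(y)`. [folklore] -/
theorem arg_add (L : ℝ) (k : Fin 3 → ℤ) (x y : Space) : arg L k (x + y) = arg L k x + arg L k y := by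
  unfold arg
  rw [← mul_add, ← Finset.sum_add_distrib]
  congr 1
  refine Finset.sum_congr rfl fun i _ => ?_
  rw [PiLp.add_apply]
  ring

/-- `Im e_k(x) = sin θ_k(x)`. [folklore] -/
theorem im_cellWave (L : ℝ) (k : Fin 3 → ℤ) (x : Space) :
    (cellWave L k x).im = Real.sin (arg L k x) := by
  rw [cellWave_apply]
  have : (2 * Real.pi * Complex.I * (∑ i, (k i : ℝ) * x i : ℝ) / L : ℂ) =
      ((arg L k x : ℝ) : ℂ) * Complex.I := by
    unfold arg
    push_cast
    ring
  push_cast at this ⊢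
  rw [this, Complex.exp_ofReal_mul_I_im]

/-- `∫_{[0,L)³} sin θ_k = 0` for `k ≠ 0`. [folklore] -/
theorem integral_cell_sin_arg (hL : 0 < L) {k : Fin 3 → ℤ} (hk : k ≠ 0) :
    ∫ x in cell L, Real.sin (arg L k x) = 0 := by
  have h := integral_cell_cellWave_eq_zero hL hk
  have hint : Integrable (cellWave L k) (volume.restrict (cell L)) :=
    integrableOn_cell (continuous_cellWave L k)
  have h2 := integral_im hint
  simp only [RCLike.im_to_complex, im_cellWave] at h2
  rw [h2, h, Complex.zero_im]

/-- `∫_{[0,L)³} cos(θ_k + α) = 0` for `k ≠ 0` and every phase `α`. [folklore] -/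
theorem integral_cell_cos_arg_add (hL : 0 < L) {k : Fin 3 → ℤ} (hk : k ≠ 0) (α : ℝ) :
    ∫ x in cell L, Real.cos (arg L k x + α) = 0 := by
  simp_rw [Real.cos_add]
  have i1 : Integrable (fun x => Real.cos (arg L k x) * Real.cos α) (volume.restrict (cell L)) :=
    integrableOn_cell (by fun_prop)
  have i2 : Integrable (fun x => Real.sin (arg L k x) * Real.sin α) (volume.restrict (cell L)) :=
    integrableOn_cell (by fun_prop)
  rw [integral_sub i1 i2, integral_mul_const, integral_mul_const, integral_cell_cos_arg hL hk,
    integral_cell_sin_arg hL hk]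
  ring

/-- Pointwise trigonometry for the shifted product:
`φ_ε(x+r)φ_ε(x) = 1 + 2ε cos(θx+θr) + 2ε cos θx + 2ε²(cos θr + cos(θ_{2k}x + θr))`. [folklore] -/
theorem phiMode_shift_mul (L : ℝ) (k : Fin 3 → ℤ) (ε : ℝ) (x r : Space) :
    phiMode L k ε (x + r) * phiMode L k ε x =
      (1 + 2 * ε ^ 2 * Real.cos (arg L k r)) +
        (2 * ε * Real.cos (arg L k x + arg L k r) + 2 * ε * Real.cos (arg L k x) +
          2 * ε ^ 2 * Real.cos (arg L ((2 : ℤ) • k) x + arg L k r)) := by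
  unfold phiMode
  rw [arg_add, arg_intSMul, show ((2 : ℤ) : ℝ) * arg L k x = 2 * arg L k x by push_cast; ring,
    Real.cos_add, Real.cos_add, Real.cos_two_mul, Real.sin_two_mul]
  ring

/-- **The shifted overlap of the modulated mode**:
`∫_cell φ_ε(x + r) φ_ε(x) dx = (1 + 2ε² cos θ_k(r)) L³` (`k ≠ 0`). [folklore] -/
theorem integral_cell_phiMode_shift_mul (hL : 0 < L) {k : Fin 3 → ℤ} (hk : k ≠ 0) (ε : ℝ)
    (r : Space) :
    ∫ x in cell L, phiMode L k ε (x + r) * phiMode L k ε x =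
      (1 + 2 * ε ^ 2 * Real.cos (arg L k r)) * L ^ 3 := by
  simp_rw [phiMode_shift_mul]
  have h2k : (2 : ℤ) • k ≠ 0 := smul_ne_zero (by norm_num) hk
  have i0 : Integrable (fun _ : Space => 1 + 2 * ε ^ 2 * Real.cos (arg L k r))
      (volume.restrict (cell L)) := by
    haveI := isFiniteMeasure_restrict_cell L
    exact integrable_const _
  have i1 : Integrable (fun x => 2 * ε * Real.cos (arg L k x + arg L k r)) (volume.restrict (cell L)) :=
    integrableOn_cell (by fun_prop)
  have i2 : Integrable (fun x => 2 * ε * Real.cos (arg L k x)) (volume.restrict (cell L)) :=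
    integrableOn_cell (by fun_prop)
  have i3 : Integrable (fun x => 2 * ε ^ 2 * Real.cos (arg L ((2 : ℤ) • k) x + arg L k r))
      (volume.restrict (cell L)) := integrableOn_cell (by fun_prop)
  have i12 : Integrable (fun x => 2 * ε * Real.cos (arg L k x + arg L k r) + 2 * ε * Real.cos (arg L k x))
      (volume.restrict (cell L)) := i1.add i2
  have i123 : Integrable (fun x => 2 * ε * Real.cos (arg L k x + arg L k r) +
      2 * ε * Real.cos (arg L k x) + 2 * ε ^ 2 * Real.cos (arg L ((2 : ℤ) • k) x + arg L k r))
      (volume.restrict (cell L)) := i12.add i3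
  rw [integral_add i0 i123, integral_add i12 i3, integral_add i1 i2,
    integral_const_mul, integral_const_mul, integral_const_mul, integral_cell_cos_arg_add hL hk,
    integral_cell_cos_arg hL hk, integral_cell_cos_arg_add hL h2k, integral_cell_const hL]
  ring

/-- **Elementary log bound**: `t(1 − t) w² ≤ w · log(1 + t w)` for `0 ≤ t ≤ 1/2`, `|w| ≤ 1`
(from `1 − 1/y ≤ log y ≤ y − 1`; the sign of `w` decides which side is used). [folklore] -/
theorem mul_log_one_add_mul_ge {t w : ℝ} (ht : 0 ≤ t) (ht' : t ≤ 1 / 2) (hw : |w| ≤ 1) :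
    t * (1 - t) * w ^ 2 ≤ w * Real.log (1 + t * w) := by
  have hw1 : -1 ≤ w := by linarith [neg_abs_le w]
  have hw2 : w ≤ 1 := by linarith [le_abs_self w]
  have hpos : 0 < 1 + t * w := by nlinarith
  rcases le_or_gt 0 w with hw0 | hw0
  · -- `w ≥ 0`: use `log y ≥ 1 − 1/y`, i.e. `log(1+tw) ≥ tw/(1+tw) ≥ tw(1−t)`
    have h1 : 1 - (1 + t * w)⁻¹ ≤ Real.log (1 + t * w) := Real.one_sub_inv_le_log_of_pos hpos
    have h2 : t * w * (1 - t) ≤ 1 - (1 + t * w)⁻¹ := by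
      rw [show 1 - (1 + t * w)⁻¹ = t * w / (1 + t * w) by field_simp; ring]
      rw [le_div_iff₀ hpos]
      have hk : t * w - t * w * (1 - t) * (1 + t * w) = t ^ 2 * w * (1 - w + t * w) := by ring
      have hk' : 0 ≤ t ^ 2 * w * (1 - w + t * w) :=
        mul_nonneg (mul_nonneg (sq_nonneg t) hw0) (by nlinarith [mul_nonneg ht hw0])
      linarith
    calc t * (1 - t) * w ^ 2 = w * (t * w * (1 - t)) := by ring
      _ ≤ w * Real.log (1 + t * w) := mul_le_mul_of_nonneg_left (h2.trans h1) hw0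
  · -- `w < 0`: use `log y ≤ y − 1`, i.e. `log(1+tw) ≤ tw`, and multiply by `w < 0`
    have h1 : Real.log (1 + t * w) ≤ t * w := by
      have := Real.log_le_sub_one_of_pos hpos; linarith
    have h2 : w * (t * w) ≤ w * Real.log (1 + t * w) := mul_le_mul_of_nonpos_left h1 hw0.le
    have h3 : t * (1 - t) * w ^ 2 ≤ w * (t * w) := by nlinarith [sq_nonneg (t * w)]
    exact h3.trans h2

/-- Fubini for products of REAL one-body factors on `cell^N`. [folklore] -/
theorem integral_cellN_prod_real {N : ℕ} (f : Fin N → Space → ℝ) :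
    ∫ X in cellN N L, ∏ i, f i (X i) = ∏ i, ∫ x in cell L, f i x := by
  rw [volume_restrict_cellN]
  exact integral_fintype_prod_eq_prod (𝕜 := ℝ) f

/-- **Weighted Jensen / Cauchy–Schwarz on `cell^N`**: for continuous real `f` and an admissible
state `Ψ` (so `∫_{cell^N}|Ψ|² = 1`), `(∫ f|Ψ|²)² ≤ ∫ f²|Ψ|²`. [folklore] -/
theorem sq_integral_le_integral_sq {N : ℕ} {f : Config N → ℝ} (hf : Continuous f)
    (Ψ : PeriodicTrialState N L) :
    (∫ X in cellN N L, f X * ‖Ψ.ψ X‖ ^ 2) ^ 2 ≤ ∫ X in cellN N L, f X ^ 2 * ‖Ψ.ψ X‖ ^ 2 := by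
  set m : ℝ := ∫ X in cellN N L, f X * ‖Ψ.ψ X‖ ^ 2 with hm
  have hw : Continuous fun X => ‖Ψ.ψ X‖ ^ 2 := (Ψ.contDiff.continuous.norm).pow 2
  have i2 : Integrable (fun X => f X ^ 2 * ‖Ψ.ψ X‖ ^ 2) (volume.restrict (cellN N L)) :=
    integrableOn_cellN ((hf.pow 2).mul hw) L
  have i1 : Integrable (fun X => f X * ‖Ψ.ψ X‖ ^ 2) (volume.restrict (cellN N L)) :=
    integrableOn_cellN (hf.mul hw) L
  have i0 : Integrable (fun X => ‖Ψ.ψ X‖ ^ 2) (volume.restrict (cellN N L)) :=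
    integrableOn_cellN hw L
  have key : 0 ≤ ∫ X in cellN N L, (f X - m) ^ 2 * ‖Ψ.ψ X‖ ^ 2 :=
    integral_nonneg fun X => by positivity
  have hexp : ∀ X, (f X - m) ^ 2 * ‖Ψ.ψ X‖ ^ 2 =
      f X ^ 2 * ‖Ψ.ψ X‖ ^ 2 - 2 * m * (f X * ‖Ψ.ψ X‖ ^ 2) + m ^ 2 * ‖Ψ.ψ X‖ ^ 2 := fun X => by ring
  simp_rw [hexp] at key
  have iA : Integrable (fun X => f X ^ 2 * ‖Ψ.ψ X‖ ^ 2 - 2 * m * (f X * ‖Ψ.ψ X‖ ^ 2))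
      (volume.restrict (cellN N L)) := i2.sub (i1.const_mul _)
  have iB : Integrable (fun X => m ^ 2 * ‖Ψ.ψ X‖ ^ 2) (volume.restrict (cellN N L)) :=
    i0.const_mul _
  rw [integral_add iA iB, integral_sub i2 (i1.const_mul _),
    integral_const_mul, integral_const_mul, integral_norm_sq_eq_one, ← hm] at key
  nlinarith [key]

end Toolkit


end Summit.AtomisticToContinuum.BoseEinsteinCondensation.Theorems.InfraredMinimumUncertainty.Negative

end
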